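import Literature.Analysis.FluidPDE.OnsagerBDSVOscillationCorrectorProof
import Literature.Analysis.FluidPDE.OnsagerBDSVPotentialTheoryProofs
import Literature.Analysis.FluidPDE.OnsagerBDSVPrincipalPartBound
import Literature.Analysis.FluidPDE.OnsagerBDSVCorrectorBoundsProofs
import HarnessLib

/-!
# The BDSV oscillation error: discharge of the corrector estimate `𝒪₂` (arXiv (6.9))

Buckmaster–De Lellis–Székelyhidi–Vicol (BDSV), *Onsager's conjecture for admissible weak
solutions*, CPAM 72 (2019) = arXiv:1701.08678, §6.1.3, arXiv (6.9):
"`‖𝒪₂‖_α ≲ ‖w_o ⊗ w_c + w_c ⊗ w_o + w_c ⊗ w_c‖_α ≲ ‖w_o‖₀‖w_c‖_α + ‖w_o‖_α‖w_c‖₀ + ‖w_c‖_α²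
≲ δ_{q+1}/(ℓλ_{q+1}^{1-α}) ≲ δ_{q+1}^{1/2}δ_q^{1/2}λ_q/λ_{q+1}^{1-α}`" — the Calderón–Zygmund bound for
`ℛ div` (Prop. C.1), the product rule (A.2), interpolation (A.3) and the bounds of Cor. 5.8 on `w_o`,
`w_c`. This file DISCHARGES the named fact `BDSV.oscillationCorrectorEstimate` of
`OnsagerBDSVOscillationSplit.lean`:

  `BDSV.oscillationCorrectorEstimate_holds : oscillationCorrectorEstimate`,

by feeding the tree's conditional proof `BDSV.oscillationCorrectorEstimate_of_bounds :
holderCZBound → principalPartBound → correctorPartBound → oscillationCorrectorEstimate`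
(`OnsagerBDSVOscillationCorrectorProof.lean`, the whole display (6.9) with its interpolation,
product and scale bookkeeping) with the three discharges now in the tree: Prop. C.1
(`BDSV.holderCZBound_holds`, `OnsagerBDSVPotentialTheoryProofs.lean`) and the two lines of Cor. 5.8,
arXiv (5.29) (`BDSV.principalPartBound_holds`, `OnsagerBDSVPrincipalPartBound.lean`) and arXiv (5.30)
(`BDSV.correctorPartBound_holds`, `OnsagerBDSVCorrectorBoundsProofs.lean`).

## References

* T. Buckmaster, C. De Lellis, L. Székelyhidi Jr., V. Vicol, *Onsager's conjecture for admissible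
  weak solutions*, Comm. Pure Appl. Math. 72 (2019) 229–274 = arXiv:1701.08678, §6.1.3
  (arXiv (6.9)); §5.5 Cor. 5.8 (arXiv (5.29)–(5.30)); App. A (A.2)–(A.3); App. C Prop. C.1.
  Equation numbers as in arXiv:1701.08678v1 (cf. `OnsagerBDSVStressSplit.lean`, "Numbering").
-/

noncomputable section

namespace Literature.Analysis.FluidPDE.BDSV

/-- **The corrector oscillation term `𝒪₂` is bounded as printed** (BDSV §6.1.3, arXiv (6.9):
"`‖𝒪₂‖_α ≲ ‖w_o‖₀‖w_c‖_α + ‖w_o‖_α‖w_c‖₀ + ‖w_c‖_α² ≲ δ_{q+1}/(ℓλ_{q+1}^{1-α})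
≲ δ_{q+1}^{1/2}δ_q^{1/2}λ_q/λ_{q+1}^{1-α}`"): the named fact `BDSV.oscillationCorrectorEstimate` —
along the common prefix, the `C^{0,α}` norms of `𝒪₂ = ℛ div(w_o ⊗ w_c + w_c ⊗ w_o + w_c ⊗ w_c)` on
`[0,T]` are at most `C δ_{q+1}^{1/2} δ_q^{1/2} λ_q λ_{q+1}^{-(1-4α)}` — holds: the conditional proof
`BDSV.oscillationCorrectorEstimate_of_bounds` (Prop. C.1 for `ℛ div`, the product rule and
interpolation, the scale comparison of (6.9) and the threshold `ℓλ_{q+1} ≥ 1` of arXiv (6.4)) applied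
to the discharges of Prop. C.1 (`BDSV.holderCZBound_holds`) and of Cor. 5.8
(`BDSV.principalPartBound_holds`, `BDSV.correctorPartBound_holds`).
[cite: BuckmasterEtAl2018, §6.1.3 (arXiv (6.9)) with Cor. 5.8 (arXiv (5.29)–(5.30)) and Prop. C.1] -/
theorem oscillationCorrectorEstimate_holds : oscillationCorrectorEstimate :=
  oscillationCorrectorEstimate_of_bounds holderCZBound_holds principalPartBound_holds
    correctorPartBound_holds

end Literature.Analysis.FluidPDE.BDSV
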